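import Literature.Computability.ImplicitComplexity.STASubstLemma
import Literature.Computability.ImplicitComplexity.SoftTypeAssignmentLmoRename
import HarnessLib

/-!
# Weighted subject reduction for `STA` (GMR08 Lemma 3.4)

Support file for the `PTIME` soundness half of `STACapturesP` (GMR08 Thm. 3.5): "The weight of
a proof decreases when a β-reduction is performed" (GMR08 §3.1, Lemma 3.4 = GR07 Lemma 4.5):
if `Π ▹ Γ ⊢ M : σ` and `M →β M'` then `Π' ▹ Γ ⊢ M' : σ` with `W(Π', r) < W(Π, r)` for every
`r ≥ rk(Π)` (and `rk`, `d` do not increase).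

* `MTyping.gen_lam` — generation lemma for abstractions (GR07 Lemma 4.1 (ii)): a derivation of
  `Γ ⊢ λx.P : σ ⊸ A` of weight `w` contains a derivation of `Γ, x : σ ⊢ P : A` of weight
  `w - 1` (same degree and rank bound); the `(∀I)`/`(∀E)` détours and trailing `(w)`/`(m)` of
  the spine are removed by type substitution inside the derivation (`MTyping.substT`). The
  induction carries a pending type substitution and a list of pending instantiations
  (`LinTy.instList`).
* (uses the tree's `Red.of_rename`, `SoftTypeAssignmentLmoRename`: a β-step of a renamed term is the renaming of a β-step — needed under `(m)`,
  whose subject is a renaming of its premise's subject).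
* `MTyping.subject_reduction` — **weighted subject reduction**: for `r ≥ 1`, one `→β` step from
  a typed term yields a derivation of the reduct with strictly smaller weight and no larger
  degree, in the same context with the same type; the β-case is the substitution lemma
  `MTyping.substitution` applied to the generation lemma.

## References

* [GaboardiMarionRonchidellarocca2008] GMR08, §3.1 (Lemma 3.4), Table 2.
* [GaboardiRonchiDellaRocca2007] GR07, Lemma 4.1 (Generation), Lemma 4.5 (weighted subject
  reduction).
-/

namespace Literature.Computability.ImplicitComplexity

namespace STA

/-! ### Iterated instantiation of leading quantifiers -/

/-- Instantiate the leading `∀`s of a linear type by the given list of linear types, as a chain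
of `(∀E)` rules would; `none` if the type runs out of quantifiers. [folklore] -/
def LinTy.instList : LinTy → List LinTy → Option LinTy
  | T, [] => some T
  | .all B, A :: rest => LinTy.instList (B.inst A) rest
  | .tvar _, _ :: _ => none
  | .limp _ _ _, _ :: _ => none

/-- An arrow type has no leading quantifier to instantiate. [folklore] -/
theorem LinTy.instList_limp {k : ℕ} {B A : LinTy} {args : List LinTy} {C : LinTy}
    (h : LinTy.instList (.limp k B A) args = some C) : args = [] ∧ C = .limp k B A := by
  cases args with
  | nil => simp [LinTy.instList] at h; exact ⟨rfl, h.symm⟩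
  | cons a rest => simp [LinTy.instList] at h

namespace MTyping

variable {r : ℕ}

/-- Generation for abstractions, generalized along the non-syntax-directed spine: pending type
substitution `θ` and pending instantiations `args`. [cite: GaboardiMarionRonchidellarocca2008, Table 2] -/
theorem gen_lam_aux {d w : ℕ} {Γ : Ctx} {M : Term} {τ : SoftTy} (h : MTyping r w d Γ M τ) :
    ∀ {P : Term}, M = .lam P → τ.bangs = 0 →
    ∀ (θ : ℕ → LinTy) (args : List LinTy) {k : ℕ} {B A : LinTy},
      LinTy.instList (τ.lin.substp θ) args = some (.limp k B A) →
      ∃ w', w = w' + 1 ∧ MTyping r w' d (Ctx.cons (some ⟨k, B⟩) (Γ.substT θ)) P ⟨0, A⟩ := by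
  induction h with
  | ax _ => intro P hM; cases hM
  | @weak d w Γ₀ Γ M τ j A₀ h₀ hj hΓ ih =>
    intro P hM hb θ args k B A hinst
    obtain ⟨w', hw, hder⟩ := ih hM hb θ args hinst
    refine ⟨w', hw, MTyping.weak (j + 1) (A₀.substp θ) hder (by simp [Ctx.cons, hj]) ?_⟩
    funext i
    cases i with
    | zero => simp [Ctx.cons]
    | succ i =>
      rw [hΓ]
      by_cases hij : i = j
      · subst hij; simp [Ctx.cons, SoftTy.substT]
      · have : i + 1 ≠ j + 1 := by omega
        simp [Ctx.cons, Function.update_of_ne hij, Function.update_of_ne this]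
  | @lam d w Γ M k₀ B₀ A₀ h₀ _ =>
    intro P hM hb θ args k B A hinst
    cases hM
    simp only [LinTy.substp] at hinst
    obtain ⟨-, hC⟩ := LinTy.instList_limp hinst
    simp only [LinTy.limp.injEq] at hC
    obtain ⟨rfl, rfl, rfl⟩ := hC
    refine ⟨w, rfl, ?_⟩
    have := h₀.substT θ
    rw [Ctx.substT_cons] at this
    exact this
  | app _ _ _ => intro P hM; cases hM
  | @mpx d w Γ₀ Γ M₀ M μ σ S j h₀ hS hj hr hΓ hM ih =>
    intro P hMP hb θ args k B A hinst
    -- the premise's subject is an abstraction too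
    obtain ⟨P₀, rfl, hP⟩ : ∃ P₀, M₀ = .lam P₀ ∧ P = P₀.rename (liftRen (mpxRen S j)) := by
      rw [hMP] at hM
      cases M₀ with
      | var i => simp [Term.rename] at hM
      | app a b => simp [Term.rename] at hM
      | lam P₀ =>
        simp only [Term.rename, Term.lam.injEq] at hM
        exact ⟨P₀, rfl, hM⟩
      | sum a b => simp [Term.rename] at hM
    obtain ⟨w', hw, hder⟩ := ih rfl hb θ args hinst
    have hjS : j ∉ S := fun hjS => by rw [hS j hjS] at hj; cases hj
    have hinj : Function.Injective Nat.succ := Nat.succ_injective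
    refine ⟨w', hw, MTyping.mpx (σ := σ.substT θ) (S.image Nat.succ) (j + 1) hder ?_ ?_ ?_ ?_ ?_⟩
    · intro i hi
      obtain ⟨i₀, hi₀, rfl⟩ := Finset.mem_image.1 hi
      simp [Ctx.cons, hS i₀ hi₀]
    · simp [Ctx.cons, hj]
    · rw [Finset.card_image_of_injective _ hinj]; exact hr
    · funext i
      cases i with
      | zero =>
        have h0 : (0 : ℕ) ∉ S.image Nat.succ := by simp
        simp [Ctx.cons, Ctx.mpx, h0]
      | succ i =>
        have hmem : (i + 1) ∈ S.image Nat.succ ↔ i ∈ S := by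
          simp only [Finset.mem_image, Nat.succ_eq_add_one]
          constructor
          · rintro ⟨a, ha, he⟩
            have : a = i := by omega
            subst this; exact ha
          · intro hi; exact ⟨i, hi, rfl⟩
        rw [hΓ]
        by_cases hiS : i ∈ S
        · simp [Ctx.cons, Ctx.mpx, hiS, hmem.2 hiS]
        · have h1 : (i + 1) ∉ S.image Nat.succ := fun h => hiS (hmem.1 h)
          by_cases hij : i = j
          · subst hij; simp [Ctx.cons, Ctx.mpx, hiS, h1, SoftTy.substT_bang]
          · simp [Ctx.cons, Ctx.mpx, hiS, h1, hij]
    · rw [hP]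
      refine Term.rename_congr (fun i => ?_) P₀
      cases i with
      | zero =>
        have h0 : (0 : ℕ) ∉ S.image Nat.succ := by simp
        simp [mpxRen, h0]
      | succ i =>
        have hmem : (i + 1) ∈ S.image Nat.succ ↔ i ∈ S := by
          simp only [Finset.mem_image, Nat.succ_eq_add_one]
          constructor
          · rintro ⟨a, ha, he⟩
            have : a = i := by omega
            subst this; exact ha
          · intro hi; exact ⟨i, hi, rfl⟩
        by_cases hiS : i ∈ S
        · simp [mpxRen, hiS, hmem.2 hiS]
        · have h1 : (i + 1) ∉ S.image Nat.succ := fun h => hiS (hmem.1 h)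
          simp [mpxRen, hiS, h1]
  | sp _ _ _ => intro P hM hb; simp at hb
  | @allI d w Γ Δ M A₀ h₀ hΔ ih =>
    intro P hM hb θ args k B A hinst
    simp only [LinTy.substp] at hinst
    cases args with
    | nil => simp [LinTy.instList] at hinst
    | cons A' rest =>
      simp only [LinTy.instList] at hinst
      -- instantiate `α₀ := A'` and substitute `θ` in one go inside the premise
      let θ' : ℕ → LinTy := fun i => (LinTy.up θ i).substp (LinTy.consT A')
      have hθ'0 : θ' 0 = A' := rfl
      have hθ's : ∀ i, θ' (i + 1) = θ i := fun i => by
        show ((θ i).rename Nat.succ).substp (LinTy.consT A') = θ i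
        rw [LinTy.substp_rename]
        exact (LinTy.substp_congr (fun j => rfl) _).trans (LinTy.substp_tvar _)
      have hA : A₀.substp θ' = (A₀.substp (LinTy.up θ)).inst A' := by
        rw [LinTy.inst_eq_substp, LinTy.substp_substp]
      have hΓθ : Δ.substT θ' = Γ.substT θ := by
        rw [hΔ]
        funext i
        simp only [Ctx.substT_apply, Ctx.shift, Option.map_map]
        cases Γ i with
        | none => rfl
        | some τ₀ =>
          simp only [Option.map_some, Function.comp_apply, SoftTy.substT, SoftTy.shift,
            Option.some.injEq, SoftTy.mk.injEq, true_and]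
          rw [LinTy.substp_rename]
          exact LinTy.substp_congr (fun j => hθ's j) _
      have hinst' : LinTy.instList (A₀.substp θ') rest = some (.limp k B A) := by
        rw [hA]; exact hinst
      obtain ⟨w', hw, hder⟩ := ih hM rfl θ' rest hinst'
      rw [hΓθ] at hder
      exact ⟨w', hw, hder⟩
  | @allE d w Γ M B₀ A' h₀ ih =>
    intro P hM hb θ args k B A hinst
    simp only at hinst
    refine ih hM rfl θ (A'.substp θ :: args) ?_
    simp only [LinTy.substp, LinTy.instList]
    rw [← LinTy.inst_substp]
    exact hinst

/-- **Generation lemma for abstractions** (GR07 Lemma 4.1): a weighted derivation of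
`Γ ⊢ λx.P : σ ⊸ A` contains one of `Γ, x : σ ⊢ P : A` with the same rank bound and degree and
weight one less. [cite: GaboardiMarionRonchidellarocca2008, Table 2 (⊸I)] -/
theorem gen_lam {d w : ℕ} {Γ : Ctx} {P : Term} {k : ℕ} {B A : LinTy}
    (h : MTyping r w d Γ (.lam P) ⟨0, .limp k B A⟩) :
    ∃ w', w = w' + 1 ∧ MTyping r w' d (Ctx.cons (some ⟨k, B⟩) Γ) P ⟨0, A⟩ := by
  obtain ⟨w', hw, hder⟩ := gen_lam_aux h rfl rfl LinTy.tvar [] (k := k) (B := B) (A := A)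
    (by simp [LinTy.instList, LinTy.substp_tvar])
  refine ⟨w', hw, ?_⟩
  have hΓ : Γ.substT LinTy.tvar = Γ := by
    funext i
    simp only [Ctx.substT_apply]
    cases Γ i with
    | none => rfl
    | some τ => simp [SoftTy.substT, LinTy.substp_tvar]
  rwa [hΓ] at hder

end MTyping

/-! ### Weighted subject reduction -/

namespace MTyping

variable {r : ℕ}

/-- The substitution data of a β-redex: slot `0` (the bound variable, type `σ`) receives the
argument `N` with its derivation in `Γ₂`, every other slot `i + 1` is renamed to `i` (the binder
disappears). [cite: GaboardiMarionRonchidellarocca2008, Lemma 3.4] -/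
theorem substData_beta {d₂ w₂ : ℕ} {Γ Γ₁ Γ₂ : Ctx} {N : Term} {σ : SoftTy}
    (hs : Γ.Split Γ₁ Γ₂) (h₂ : MTyping r w₂ d₂ Γ₂ N σ) {D : ℕ} (hd : d₂ ≤ D)
    {n : ℕ} (hn : Γ.BoundedBy n) :
    SubstData r D (Ctx.cons (some σ) Γ₁) (Term.consSub N)
      (fun i => match i with
        | 0 => Γ₂
        | i + 1 => fun i' => if i' = i then Γ₁ i else none)
      (fun i => match i with
        | 0 => w₂
        | _ + 1 => 0) where
  slot i τ hτ := by
    cases i with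
    | zero =>
      simp only [Ctx.cons, Option.some.injEq] at hτ
      subst hτ
      exact Or.inr ⟨d₂, hd, h₂⟩
    | succ i =>
      simp only [Ctx.cons] at hτ
      exact Or.inl ⟨i, rfl, ⟨by simp [hτ], fun j hj => by simp [hj]⟩, rfl⟩
  off i hi := by
    cases i with
    | zero => simp [Ctx.cons] at hi
    | succ i =>
      simp only [Ctx.cons] at hi
      refine ⟨fun i' => ?_, rfl⟩
      by_cases h : i' = i
      · subst h; simp [hi]
      · simp [h]
  disj i₁ i₂ i' hne h := by
    cases i₁ with
    | zero =>
      cases i₂ with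
      | zero => exact absurd rfl hne
      | succ i₂ =>
        simp only at h ⊢
        by_cases h' : i' = i₂
        · subst h'
          rcases hs i' with ⟨-, e⟩ | ⟨e, -⟩
          · exact absurd e h
          · simp [e]
        · simp [h']
    | succ i₁ =>
      simp only at h
      by_cases h' : i' = i₁
      · subst h'
        simp only [if_true] at h
        cases i₂ with
        | zero =>
          simp only
          rcases hs i' with ⟨-, e⟩ | ⟨e, -⟩
          · exact e
          · exact absurd e h
        | succ i₂ =>
          have : i' ≠ i₂ := fun e => hne (by rw [e])
          simp [this]
      · simp [h'] at h
  bdd := by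
    refine ⟨n, fun i i' hi' => ?_⟩
    cases i with
    | zero =>
      simp only
      rcases hs i' with ⟨-, e⟩ | ⟨-, e⟩
      · exact e
      · rw [e]; exact hn i' hi'
    | succ i =>
      simp only
      by_cases h' : i' = i
      · subst h'
        simp only [if_true]
        rcases hs i' with ⟨e, -⟩ | ⟨e, -⟩
        · rw [e]; exact hn i' hi'
        · exact e
      · simp [h']

/-- **Weighted subject reduction** (GMR08 Lemma 3.4, GR07 Lemma 4.5): for `r ≥ 1`, if
`Γ ⊢ M : σ` is derivable with degree `d`, ranks `≤ r` and weight `w`, and `M →β M'`, then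
`Γ ⊢ M' : σ` is derivable with degree `≤ d`, ranks `≤ r` and weight `< w`.
[cite: GaboardiMarionRonchidellarocca2008, Lemma 3.4 (§3.1)] -/
theorem subject_reduction {d w : ℕ} {Γ : Ctx} {M M' : Term} {σ : SoftTy}
    (h : MTyping r w d Γ M σ) (hr : 1 ≤ r) (hred : Red M M') :
    ∃ d' w', d' ≤ d ∧ w' < w ∧ MTyping r w' d' Γ M' σ := by
  induction h generalizing M' with
  | ax hs => cases hred
  | @weak d w Γ₀ Γ M τ j A h₀ hj hΓ ih =>
    obtain ⟨d', w', hd, hw, hder⟩ := ih hred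
    exact ⟨d', w', hd, hw, MTyping.weak j A hder hj hΓ⟩
  | @lam d w Γ M k B A h₀ ih =>
    cases hred with
    | lam hst =>
      obtain ⟨d', w', hd, hw, hder⟩ := ih hst
      exact ⟨d', w' + 1, hd, by omega, MTyping.lam hder⟩
  | @app d₁ d₂ w₁ w₂ Γ Γ₁ Γ₂ M N k B A hs h₁ h₂ ih₁ ih₂ =>
    cases hred with
    | beta P N =>
      -- the β-case: generation + substitution lemma
      obtain ⟨w₁', hw₁, hP⟩ := h₁.gen_lam
      obtain ⟨n₁, hn₁⟩ := h₁.exists_boundedBy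
      obtain ⟨n₂, hn₂⟩ := h₂.exists_boundedBy
      have hnΓ : Γ.BoundedBy (max n₁ n₂) := fun i hi => by
        rcases hs i with ⟨e, -⟩ | ⟨-, e⟩
        · rw [← e]; exact hn₁ i (le_of_max_le_left hi)
        · rw [← e]; exact hn₂ i (le_of_max_le_right hi)
      have hSD := substData_beta hs h₂ (le_max_right d₁ d₂) hnΓ
      have hnc : (Ctx.cons (some ⟨k, B⟩) Γ₁).BoundedBy (max n₁ n₂ + 1) := fun i hi => by
        cases i with
        | zero => omega
        | succ i => exact hn₁ i (by omega)
      obtain ⟨d', w', hd', hw', hder⟩ :=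
        hP.substitution (le_max_left d₁ d₂) hSD hnc
      have hsum : (Finset.range (max n₁ n₂ + 1)).sum
          (fun i => match i with | 0 => w₂ | _ + 1 => 0) = w₂ := by
        rw [Finset.sum_range_succ']
        simp
      rw [hsum] at hw'
      have hU : Ctx.iUnion (fun i => match i with
          | 0 => Γ₂
          | i + 1 => fun i' => if i' = i then Γ₁ i else none) = Γ := by
        refine Ctx.iUnion_eq_of hSD.disj (fun i i' hi => ?_) (fun i' hi' => ?_)
        · cases i with
          | zero =>
            rcases hs i' with ⟨-, e⟩ | ⟨-, e⟩
            · exact absurd e hi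
            · exact e.symm
          | succ i =>
            simp only at hi ⊢
            by_cases h' : i' = i
            · subst h'
              simp only [if_true] at hi ⊢
              rcases hs i' with ⟨e, -⟩ | ⟨e, -⟩
              · exact e.symm
              · exact absurd e hi
            · simp [h'] at hi
        · rcases hs i' with ⟨e₁, -⟩ | ⟨-, e₂⟩
          · refine ⟨i' + 1, ?_⟩
            simp only [if_true]
            rwa [e₁]
          · exact ⟨0, by simp only; rwa [e₂]⟩
      rw [hU, ← Term.subst0_eq_substp] at hder
      exact ⟨d', w', hd', by omega, hder⟩
    | appL _ hst =>
      obtain ⟨d', w', hd, hw, hder⟩ := ih₁ hst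
      exact ⟨max d' d₂, w' + w₂ + 1, max_le_max hd le_rfl, by omega, MTyping.app hs hder h₂⟩
    | appR _ hst =>
      obtain ⟨d', w', hd, hw, hder⟩ := ih₂ hst
      exact ⟨max d₁ d', w₁ + w' + 1, max_le_max le_rfl hd, by omega, MTyping.app hs h₁ hder⟩
  | @mpx d w Γ₀ Γ M₀ M μ σ S j h₀ hS hj hrk hΓ hM ih =>
    rw [hM] at hred
    obtain ⟨M₀', hst, rfl⟩ := Red.of_rename hred
    obtain ⟨d', w', hd, hw, hder⟩ := ih hst
    exact ⟨d', w', hd, hw, MTyping.mpx S j hder hS hj hrk hΓ rfl⟩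
  | @sp d w Γ₀ Γ M k A h₀ hΓ ih =>
    obtain ⟨d', w', hd, hw, hder⟩ := ih hred
    exact ⟨d' + 1, r * w', by omega, Nat.mul_lt_mul_of_pos_left hw hr, MTyping.sp hder hΓ⟩
  | @allI d w Γ Δ M A h₀ hΔ ih =>
    obtain ⟨d', w', hd, hw, hder⟩ := ih hred
    exact ⟨d', w', hd, hw, MTyping.allI hder hΔ⟩
  | @allE d w Γ M B A h₀ ih =>
    obtain ⟨d', w', hd, hw, hder⟩ := ih hred
    exact ⟨d', w', hd, hw, MTyping.allE A hder⟩

end MTyping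

end STA

end Literature.Computability.ImplicitComplexity
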